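import Literature.AlgebraicTopology.SingularHomology.GysinMap
import Literature.AlgebraicTopology.SingularHomology.FundamentalClassExistence
import HarnessLib

/-!
# Change of orientation: fundamental classes, Poincaré duality maps and Gysin homomorphisms
# of two `R`-orientations of a closed connected manifold differ by a unit

Companion to `FundamentalClass` / `FundamentalClassExistence` (Hatcher 2002, §3.3, Thm. 3.26:
existence and uniqueness of the fundamental class `[X]_μ ∈ Hₙ(X; R)` of an `R`-orientation `μ` of
a closed `n`-manifold, and injectivity of `Hₙ(X; R) → Hₙ(X | x; R)` for `X` connected) and to
`GysinMap` (the Gysin homomorphism `f_! = D_X⁻¹ ∘ f_* ∘ D_Y` of Fulton, *Young Tableaux*, App. B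
§B.1 (5), relative to orientations `μ_Y`, `μ_X`). Everything here is PROVED:

* `HomologicalOrientation.exists_unit_localClass_eq_smul` — two local orientations at a point
  differ by a unit of `R` (both generate the free rank-one module `Hₙ(X | x; R)`; Hatcher, p. 235:
  an `R`-orientation "assigns to each `x` a generator of `Hₙ(M | x; R) ≈ R`", i.e. an element
  `u ∈ R` which is a unit);
* `HomologicalOrientation.exists_unit_fundamentalClass_eq_smul` — **on a closed CONNECTED
  manifold two `R`-orientations `μ`, `μ'` satisfy `[X]_{μ'} = u • [X]_μ` and `μ'_x = u • μ_x` for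
  all `x`, for one unit `u ∈ Rˣ`** (Hatcher, Thm. 3.26(b): `Hₙ(X; R) → Hₙ(X | x; R)` is injective,
  so the class `[X]_{μ'} − u • [X]_μ`, which dies at one point `x₀`, is zero; for `R = ℤ` this is
  "`±`", p. 236, and in general it is the transitivity of `Rˣ` on the generators of each fibre of
  the orientation covering `M_R`, p. 235);
* `poincareDualityMap_eq_smul_of_fundamentalClass_eq`,
  `HomologicalOrientation.HasPoincareDuality.of_fundamentalClass_eq_smul` — `D_{μ'} = u • D_μ`, so
  Poincaré duality for `μ` gives it for `μ'`;
* `gysinMap_eq_smul_of_fundamentalClass_eq` — **`f_!` changes by the scalar `u_X⁻¹ u_Y`** when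
  `[Y]` is replaced by `u_Y • [Y]` and `[X]` by `u_X • [X]` (`u_X` a unit): from the defining square
  `f_! y ⌢ [X] = f_* (y ⌢ [Y])` and its uniqueness clause (`eq_gysinMap_of_capProduct_eq`).

Consumer: `Literature.AlgebraicGeometry.HodgeTheory.ComplexGysinOrientation` (the Gysin morphisms
`complexGysin μ` of smooth projective complex varieties depend on the orientation family `μ` only
up to non-zero scalars, `X(ℂ)` being connected).

## References

* [HatcherAT2002] A. Hatcher, Algebraic Topology, CUP 2002, §3.3 pp. 233–236, Thm. 3.26,
  Lemma 3.27, Thm. 3.30.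
* [FultonYoungTableaux1997] W. Fulton, Young Tableaux, CUP 1997, App. B §B.1 (4)–(5).
-/

noncomputable section

open CategoryTheory

universe u v

namespace Literature.AlgebraicTopology.SingularHomology

variable {R : Type v} [CommRing R]
variable {X Y : Type u} [TopologicalSpace X] [TopologicalSpace Y]

/-! ### Two local orientations at a point differ by a unit -/

/-- **Two local orientations at a point differ by a unit.** For `R`-orientations `μ`, `μ'` of `X`
(in dimension `n`) and `x : X` there is a unit `u ∈ Rˣ` with `μ'_x = u • μ_x`: both are generators
of `Hₙ(X | x; R)`, i.e. correspond to `1` under `R`-linear identifications `e, e' : Hₙ(X | x; R) ≃ R`,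
so `μ'_x = e(μ'_x) • μ_x`, `μ_x = e'(μ_x) • μ'_x` and `e'(μ_x) e(μ'_x) = 1` (Hatcher, §3.3 p. 235:
the generators of `Hₙ(M | x; R) ≈ R` are the units of `R`). [cite: HatcherAT2002, §3.3 p. 235] -/
theorem HomologicalOrientation.exists_unit_localClass_eq_smul {n : ℕ}
    (μ μ' : HomologicalOrientation R X n) (x : X) :
    ∃ u : Rˣ, μ'.localClass x = (u : R) • μ.localClass x := by
  obtain ⟨e, he⟩ := μ.isGenerator x
  obtain ⟨e', he'⟩ := μ'.isGenerator x
  -- every local class is a multiple of a generator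
  have hgen : ∀ y, y = e y • μ.localClass x := fun y ↦
    e.injective (by rw [map_smul, he, smul_eq_mul, mul_one])
  have hgen' : ∀ y, y = e' y • μ'.localClass x := fun y ↦
    e'.injective (by rw [map_smul, he', smul_eq_mul, mul_one])
  have h1 : μ'.localClass x = e (μ'.localClass x) • μ.localClass x := hgen _
  have h2 : μ.localClass x = e' (μ.localClass x) • μ'.localClass x := hgen' _
  have hmul : e' (μ.localClass x) * e (μ'.localClass x) = 1 := by
    have h3 : μ.localClass x = (e' (μ.localClass x) * e (μ'.localClass x)) • μ.localClass x := by
      rw [mul_smul, ← h1]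
      exact h2
    have h4 := congrArg e h3
    rw [map_smul, he, smul_eq_mul, mul_one] at h4
    exact h4.symm
  exact ⟨⟨e (μ'.localClass x), e' (μ.localClass x), by rw [mul_comm]; exact hmul, hmul⟩, h1⟩

/-! ### Fundamental classes of two orientations of a closed connected manifold -/

/-- **Two `R`-orientations of a closed connected manifold have proportional fundamental classes,
the factor being a unit**: for `R`-orientations `μ`, `μ'` of a closed connected topological
`n`-manifold `X` there is `u ∈ Rˣ` with `[X]_{μ'} = u • [X]_μ` in `Hₙ(X; R)` and `μ'_x = u • μ_x`
for every `x`. Proof: at one point `x₀`, `μ'_{x₀} = u • μ_{x₀}`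
(`exists_unit_localClass_eq_smul`); the class `[X]_{μ'} − u • [X]_μ` then restricts to `0` in
`Hₙ(X | x₀; R)` (`[X]_μ ↦ μ_{x₀}`, Thm. 3.26(a)), hence vanishes because
`Hₙ(X; R) → Hₙ(X | x₀; R)` is injective for `X` connected (Thm. 3.26(b),
`singularHomology.toLocal_injective_of_connectedSpace_holds`); restricting to any other `x` gives
`μ'_x = u • μ_x`. (For `R = ℤ`: an orientable connected closed manifold has exactly the two
fundamental classes `±[X]`, Hatcher p. 236.) [cite: HatcherAT2002, §3.3 Thm. 3.26 and p. 236] -/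
theorem HomologicalOrientation.exists_unit_fundamentalClass_eq_smul {n : ℕ} [CompactSpace X]
    [T2Space X] [ChartedSpace (EuclideanSpace ℝ (Fin n)) X] [ConnectedSpace X]
    (μ μ' : HomologicalOrientation R X n) :
    ∃ u : Rˣ, μ'.fundamentalClass = (u : R) • μ.fundamentalClass ∧
      ∀ x, μ'.localClass x = (u : R) • μ.localClass x := by
  obtain ⟨x₀⟩ := (inferInstance : Nonempty X)
  obtain ⟨u, hu⟩ := μ.exists_unit_localClass_eq_smul μ' x₀
  have hμ := HomologicalOrientation.isFundamentalClass_fundamentalClass_holds (R := R) (X := X) n μ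
  have hμ' := HomologicalOrientation.isFundamentalClass_fundamentalClass_holds (R := R) (X := X) n μ'
  have hc : μ'.fundamentalClass = (u : R) • μ.fundamentalClass := by
    apply singularHomology.toLocal_injective_of_connectedSpace_holds R R X n x₀
    rw [map_smul, hμ x₀, hμ' x₀, hu]
  refine ⟨u, hc, fun x ↦ ?_⟩
  rw [← hμ' x, ← hμ x, hc, map_smul]

/-! ### Poincaré duality maps and Gysin homomorphisms under a change of orientation -/

/-- If `[X]_{μ'} = a • [X]_μ` then `D_{μ'} = a • D_μ` (`D_μ b = b ⌢ [X]_μ` is linear in `[X]_μ`).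
[cite: HatcherAT2002, §3.3 Thm. 3.30] -/
theorem poincareDualityMap_eq_smul_of_fundamentalClass_eq {n p q : ℕ}
    {μ μ' : HomologicalOrientation R X n} {a : R}
    (h : μ'.fundamentalClass = a • μ.fundamentalClass) (hpq : p + q = n) :
    poincareDualityMap μ' hpq = a • poincareDualityMap μ hpq := by
  ext b
  rw [LinearMap.smul_apply, poincareDualityMap_apply, poincareDualityMap_apply, h, map_smul]

/-- If `[X]_{μ'} = u • [X]_μ` with `u` a unit and `μ` satisfies Poincaré duality, so does `μ'`
(`D_{μ'} = u • D_μ` is `D_μ` followed by the automorphism `u • –`).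
[cite: HatcherAT2002, §3.3 Thm. 3.30] -/
theorem HomologicalOrientation.HasPoincareDuality.of_fundamentalClass_eq_smul {n : ℕ}
    {μ μ' : HomologicalOrientation R X n} (hμ : μ.HasPoincareDuality) (u : Rˣ)
    (h : μ'.fundamentalClass = (u : R) • μ.fundamentalClass) : μ'.HasPoincareDuality := by
  intro p q hpq
  rw [poincareDualityMap_eq_smul_of_fundamentalClass_eq h hpq]
  have hb : Function.Bijective (fun z : singularHomology R R X q ↦ (u : R) • z) :=
    (DistribMulAction.toLinearEquiv R (singularHomology R R X q) u).bijective
  exact hb.comp (hμ hpq)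

/-- **The Gysin homomorphism under a change of orientations.** Let `f : Y → X`, let `μ_Y, μ_Y'` be
orientations of `Y` (dimension `m`) with `[Y]_{μ_Y'} = a_Y • [Y]_{μ_Y}`, and `μ_X, μ_X'`
orientations of `X` (dimension `n`) satisfying Poincaré duality with `[X]_{μ_X'} = a_X • [X]_{μ_X}`.
If `a_X b = a_Y` then `f_!' = b • f_!` (`f_!'`, `f_!` the Gysin homomorphisms `Hᵃ(Y) → Hᶜ(X)`,
`a + q = m`, `c + q = n`, for the primed, resp. unprimed, orientations): indeed
`(b • f_! y) ⌢ [X]' = b a_X (f_! y ⌢ [X]) = a_Y f_*(y ⌢ [Y]) = f_*(y ⌢ [Y]')`, and `f_!' y` is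
characterised by this identity (Fulton (5), `eq_gysinMap_of_capProduct_eq`).
[cite: FultonYoungTableaux1997, Appendix B §B.1 (5)] [cite: HatcherAT2002, §3.3 Thm. 3.30] -/
theorem gysinMap_eq_smul_of_fundamentalClass_eq {m n : ℕ} {μY μY' : HomologicalOrientation R Y m}
    {μX μX' : HomologicalOrientation R X n} (hX : μX.HasPoincareDuality)
    (hX' : μX'.HasPoincareDuality) {aY aX b : R}
    (hY : μY'.fundamentalClass = aY • μY.fundamentalClass)
    (hXc : μX'.fundamentalClass = aX • μX.fundamentalClass) (hb : aX * b = aY) (f : C(Y, X))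
    {a c q : ℕ} (ha : a + q = m) (hc : c + q = n) :
    gysinMap μY' μX' f ha hc = b • gysinMap μY μX f ha hc := by
  ext y
  rw [LinearMap.smul_apply]
  symm
  apply eq_gysinMap_of_capProduct_eq hX' f ha hc
  rw [map_smul, LinearMap.smul_apply, hXc, map_smul, capProduct_gysinMap hX f ha hc y, hY, map_smul,
    map_smul, smul_smul, mul_comm b aX, hb]

end Literature.AlgebraicTopology.SingularHomology

end
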